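import Literature.AlgebraicGeometry.ModuliOfAbelianVarieties.SiegelLinearRigidificationBaseChange
import Literature.AlgebraicGeometry.AbelianSchemes.NormalisedBundleBaseChange
import Literature.AlgebraicGeometry.AbelianSchemes.DualIsogenyMulN
import Literature.AlgebraicGeometry.Modules.CechPicOfLocalRing
import HarnessLib

/-!
# The embedding of a family by a framed `𝒪(1)` with `𝒪(1)` normalised `≅ L^Δ(λ)³` IS a linear rigidification
# ([MumfordFogartyKirwan1994] Ch. 7 §2 Prop. 7.3 / Prop. 7.6 — the universal family over `H` is linearly rigidified)

Topic `AlgebraicGeometry/AbelianSchemes`; namespaces `Literature.AlgebraicGeometry.Modules` (§0),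
`Literature.AlgebraicGeometry.AbelianSchemes.PolarizedAbelianSchemeWithLevel` (§§1–2) and
`Literature.AlgebraicGeometry.AbelianSchemes.AbelianSchemeOver` (§3).  THEOREMS ONLY (no definition, no named fact, no instance,
no notation, no `sorry`).  Cell `hodgecm-mathlib` (D-0151), F-DAG piece (R3) of the F-6 capstone → F-8 hand-over (sequencer B-plan1 (g17)
2026-08-30 09:52:09Z; consumer: the (H-rep) file «Prop. 7.3's `H` is an instance of ★ (8α) `SiegelFramedCovariant`», whose universal
triple needs `emb` to be a ★ (8α) `IsLinearRigidification`).  Count-neutral: HC_CM is proved only modulo the 7 printed citations until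
rung 0 closes — nothing here bears on a summit statement.

## The source, as printed

[MumfordFogartyKirwan1994] Ch. 7 §2, proof of Prop. 7.3 (pp. 132–134): over the locally closed `H ⊂ Hilb(ℙ^m)` the universal closed
subscheme `Z_H ⊂ ℙ^m × H` is an abelian scheme `π : Z_H → H` (identity = the restricted section), step (V) makes `𝒪(1)|_{Z_H}`,
NORMALISED along the identity, isomorphic to `L^Δ(λ)³` for the polarisation `λ` of step (IV), and step (VI) makes
`H⁰(ℙ^m, 𝒪(1)) ⊗ 𝒪_H → π_*(𝒪(1)|_{Z_H})` an isomorphism («linearly normally embedded»).  Prop. 7.6 (p. 136) then reads the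
inclusion `Z_H ⊂ ℙ^m × H` as «a linear rigidification of `Z_H/H` with respect to `L^Δ(λ)³`» (Def. 7.5, p. 130: an isomorphism
`ℙ(π_*L^Δ(λ)³) ≅ ℙ^m × H`).  The one line the book leaves to the reader is the passage from `𝒪(1)|_{Z_H}` to `L^Δ(λ)³`: they differ by
the pull-back `π^*Q` of the line bundle `Q := (ε^*𝒪(1))^{-1}` on `H`, which is trivial LOCALLY on `H` — so the coordinate frame of
`π_*𝒪(1)` is, locally on `H`, a frame of `π_*L^Δ(λ)³` defining the same morphism to `ℙ^m`.

## What is here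

Setting of §§1–2: a triple `P = (X/T, λ, σ)` (★ `PolarizedAbelianSchemeWithLevel`), a graph datum `Gr = (1_X, λ)`, a rank-one module
`L` on `X` whose NORMALISATION `L ⊗ π^*(ε^*L)^∨` is isomorphic to `L^Δ(λ)^{⊗3} = (Gr^*𝒫)^{⊗3}` (hypothesis `hV` — the letter of
clause (V) of the tree's F-6 files), and (§2) a global frame `e : 𝒪_T^{m+1} ≅ π_*L` whose basis sections generate, read in a rank-one
frame system `F` of `L` (the letter of ★ (8α) `IsFrameRigidification` with `L` for `(Gr^*𝒫)^{⊗3}`).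

* §0 (generic, `Modules`) **`exists_openCover_cechPic_pullback_eq_one`** — every class of `Ȟ¹(T, 𝒪^×)` dies on the members of
  some open cover of `T` (the charts of a representing cocycle, ★ `CechPic.mk_eq_one_of_top_le`);
  **`nonempty_pullback_iso_pullback_of_nonempty_tensorObj_iso`** — if `L ⊗ N ≅ M` (all rank one) and the class of `N` dies along
  `k : Y → X`, then `k^*L ≅ k^*M` (rank-one classes, ★ `nonempty_iso_iff_detClass_eq`).
* §1 **`subsingleton_ext_one_pullback_of_nonempty_normalised_iso`** — `H¹(X₀, i^*L) = 0` on every field-point fibre: the twist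
  `π^*(ε^*L)^∨` dies on `Spec K` (★ `CechPic.eq_one_of_isLocalRing`), so `i^*L ≅ i^*(Gr^*𝒫)^{⊗3}` and ★ V4
  `Polarization.subsingleton_ext_one_pullback_LDelta_tensorPow'` applies — the `hvan` input of the frame transport.
* §2 **`isFrameRigidification_baseChange_of_cechPic_pullback_eq_one`** — over any `v : T″ → T` killing the class of `(ε^*L)^∨`,
  `X ×_T T″ → X → 𝐏^m_ℤ` (the point of `𝐏^m` of the frame sections of `e`) is the morphism of a GLOBAL FRAME of
  `π″_*(L^Δ(λ″)^{⊗3})` — ★ (8α-BC) `IsBaseChangeVia.isFrameRigidification_comp`'s proof with `E := L`: the module isomorphism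
  `G^*L ≅ (Gr″^*𝒫″)^{⊗3}` (§0 + ★ `IsBaseChangeVia.nonempty_iso_pullback_LDelta` + ★ `nonempty_pullback_tensorPow_iso`) and ★
  `Morphisms.exists_frame_homEquiv_pointOfSections_eq_comp` (cohomology and base change for the framed `π_*L`, `hvan` = §1);
  **`isLinearRigidification_homEquiv_pointOfSections_of_nonempty_normalised_iso`** — hence (cover `T` by §0) the point of `𝐏^m`
  of the frame sections IS A LINEAR RIGIDIFICATION of `P` (★ (8α) `IsLinearRigidification`, by its definition); and the
  rewritten form **`isLinearRigidification_of_homEquiv_pointOfSections_eq`** for a given `ι`.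
* §3 (the adapter to the F-6 clause letters, namespace `AbelianSchemeOver`)
  **`nonempty_normalised_pullback_iso_graph_tensorPow_of_LDelta_cube`** — over `b : T → S`, from clause (V)
  `pr^*(L₀ ⊗ π^*(ε^*L₀)^∨) ≅ (Γ₁^*𝒫)^{⊗3}` to the `hV` of §§1–2 for `L := pr^*L₀` on `A_T` and the graph `Gr` of `λ` over `T`
  (★ `nonempty_pullback_normalised_iso_normalised_pullback` — normalisation commutes with base change — and `Gr^*𝒫_T ≅ Γ₁^*𝒫`).

## References
* [MumfordFogartyKirwan1994] D. Mumford, J. Fogarty, F. Kirwan, *Geometric Invariant Theory*, 3rd ed. (1994), Ch. 7 §2: Def. 7.5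
  (p. 130), Prop. 7.3 and its proof, steps (V)–(VI) (pp. 132–134), Prop. 7.6 (p. 136); Ch. 6 §2 Def. 6.2 (p. 120), Prop. 6.13 (p. 123).
* [MumfordAV1970] D. Mumford, *Abelian Varieties* (1970), §5 Cor. 3 (p. 53), §16.
* [Hartshorne1977] R. Hartshorne, *Algebraic Geometry* (1977), II Thm. 7.1 (p. 150), III Ex. 4.5.
-/

noncomputable section

-- Mathlib's `Over`/pull-back API and `Scheme.Modules` section API are stated across semireducible wrappers (as in ★ (8α)).
set_option backward.isDefEq.respectTransparency false

open CategoryTheory CategoryTheory.Limits CategoryTheory.Abelian AlgebraicGeometry MonoidalCategory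
open Literature.AlgebraicGeometry.Modules
open Literature.AlgebraicGeometry.Motives Literature.AlgebraicGeometry.Motives.GeneratingSections
open Literature.AlgebraicGeometry.Morphisms Literature.AlgebraicGeometry.AbelianVarieties

universe u

/-! ## §0 Two generic facts about rank-one classes -/

namespace Literature.AlgebraicGeometry.Modules

/-- **Every class of `Ȟ¹(T, 𝒪_T^×)` is Zariski-locally trivial**: for `c ∈ CechPic T` there is an open cover of `T` on whose members
`c` pulls back to `1` — the charts `U_x` of a cocycle representing `c` (on `U_x` the pulled-back cocycle has the chart `U_x ∩ U_x = U_x`,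
★ `CechPic.mk_eq_one_of_top_le`).  «A line bundle is locally trivial.» [cite: Hartshorne1977, III Ex. 4.5] -/
theorem exists_openCover_cechPic_pullback_eq_one {T : Scheme.{u}} (c : CechPic T) :
    ∃ 𝒰 : Scheme.OpenCover.{u} T, ∀ i, CechPic.pullback (𝒰.f i) c = 1 := by
  obtain ⟨c₀, rfl⟩ := CechPic.mk_surjective c
  have hU : TopologicalSpace.IsOpenCover c₀.U :=
    top_le_iff.mp fun t _ => TopologicalSpace.Opens.mem_iSup.mpr ⟨t, c₀.mem t⟩
  refine ⟨T.openCoverOfIsOpenCover c₀.U hU, fun i ↦ ?_⟩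
  rw [Scheme.openCoverOfIsOpenCover_f, CechPic.pullback_mk]
  refine CechPic.mk_eq_one_of_top_le _ ⟨i, c₀.mem i⟩ (le_of_eq ?_)
  exact (c₀.U i).ι_preimage_self.symm

/-- **If `L ⊗ N ≅ M` with `L, M, N` of rank one and the class of `N` dies along `k : Y → X`, then `k^*L ≅ k^*M`** (rank-one
classes in `Ȟ¹(–, 𝒪^×)`: `[k^*M] = k^*[L] · k^*[N] = [k^*L]`, ★ `nonempty_iso_iff_detClass_eq`). [cite: Hartshorne1977, III Ex. 4.5] -/
theorem nonempty_pullback_iso_pullback_of_nonempty_tensorObj_iso {X Y : Scheme.{u}} {L M N : X.Modules} (hL : HasRank L 1)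
    (hM : HasRank M 1) (hN : HasRank N 1) (h : Nonempty (tensorObj L N ≅ M)) (k : Y ⟶ X)
    (hk : CechPic.pullback k (detClass (HasRank.isFiniteLocallyFree' hN)) = 1) :
    Nonempty ((Scheme.Modules.pullback k).obj L ≅ (Scheme.Modules.pullback k).obj M) := by
  obtain ⟨φ⟩ := h
  have hLN : HasRank (tensorObj L N) 1 := hasRank_tensorObj_one hL hN
  have hkL : HasRank ((Scheme.Modules.pullback k).obj L) 1 := hasRank_pullback k hL
  have hkM : HasRank ((Scheme.Modules.pullback k).obj M) 1 := hasRank_pullback k hM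
  let fL := HasRank.isFiniteLocallyFree' hL
  let fM := HasRank.isFiniteLocallyFree' hM
  let fN := HasRank.isFiniteLocallyFree' hN
  let fLN := HasRank.isFiniteLocallyFree' hLN
  let fkL := HasRank.isFiniteLocallyFree' hkL
  let fkM := HasRank.isFiniteLocallyFree' hkM
  refine (nonempty_iso_iff_detClass_eq hkL hkM fkL fkM).2 ?_
  rw [(detClass_eq_of_iso (Iso.refl _) fkL (fL.pullback k)).trans (detClass_pullback k fL),
    (detClass_eq_of_iso (Iso.refl _) fkM (fM.pullback k)).trans (detClass_pullback k fM),
    ← detClass_eq_of_iso φ fLN fM, detClass_tensorObj_of_hasRank_one hL hN fL fN fLN, map_mul, hk, mul_one]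

end Literature.AlgebraicGeometry.Modules

namespace Literature.AlgebraicGeometry.AbelianSchemes

namespace PolarizedAbelianSchemeWithLevel

variable {g N : ℕ} {δ : Fin g → ℕ} (J : Type)

variable {T : Scheme.{0}} (P : PolarizedAbelianSchemeWithLevel g N δ T)
  (Gr : P.A.X.left ⟶ P.A.prodLeft P.D.hat) (hGr₁ : Gr ≫ pullback.fst P.A.X.hom P.D.hat.X.hom = 𝟙 _)
  (hGr₂ : Gr ≫ pullback.snd P.A.X.hom P.D.hat.X.hom = P.pol.lam.left)
  {L : P.A.left.Modules} (hL : HasRank L 1)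
  (hV : Nonempty (tensorObj L ((Scheme.Modules.pullback P.A.X.hom).obj
      (Modules.dual ((Scheme.Modules.pullback P.A.unitSection).obj L))) ≅
    tensorPow ((Scheme.Modules.pullback Gr).obj P.D.P) 3))

/-! ## §1 `H¹ = 0` on the field-point fibres of `L` -/

section Vanishing

include hL hGr₁ hGr₂ hV in
/-- **`H¹(X₀, i^*L) = 0` on every field-point fibre**, for `L` of rank one with `L ⊗ π^*(ε^*L)^∨ ≅ L^Δ(λ)^{⊗3}`: over a field point
`x : Spec K → T` the twist `π^*(ε^*L)^∨` is pulled back from `Spec K`, where every class of `Ȟ¹(–, 𝒪^×)` is trivial (★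
`CechPic.eq_one_of_isLocalRing`), so `i^*L ≅ i^*(Gr^*𝒫)^{⊗3}` (§0) and [MumfordAV1970] §16 for `L^Δ(λ)^{⊗3}` (★ V4
`Polarization.subsingleton_ext_one_pullback_LDelta_tensorPow'`) transports (★ `Modules.subsingleton_ext_of_iso`).  The `hvan` input of ★
`Morphisms.exists_frame_homEquiv_pointOfSections_eq_comp` at `E := L`.
[cite: MumfordAV1970, §16 (the vanishing theorem)] [cite: MumfordFogartyKirwan1994, Ch. 7 §2 Prop. 7.3, steps (V)–(VI) of the proof (p. 134)] -/
theorem subsingleton_ext_one_pullback_of_nonempty_normalised_iso {K : Type} [Field K] (x : Spec (.of K) ⟶ T) {X₀ : Scheme.{0}}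
    {i : X₀ ⟶ P.A.X.left} {f₀ : X₀ ⟶ Spec (.of K)} (H : IsPullback i f₀ P.A.X.hom x) :
    Subsingleton (Ext.{1} (unitModule X₀) ((Scheme.Modules.pullback i).obj L) 1) := by
  have hεL : HasRank ((Scheme.Modules.pullback P.A.unitSection).obj L) 1 := hasRank_pullback _ hL
  have hQd : HasRank (Modules.dual ((Scheme.Modules.pullback P.A.unitSection).obj L)) 1 := hasRank_dual hεL
  have hQ : HasRank ((Scheme.Modules.pullback P.A.X.hom).obj
      (Modules.dual ((Scheme.Modules.pullback P.A.unitSection).obj L))) 1 := hasRank_pullback _ hQd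
  have hM3 : HasRank (tensorPow ((Scheme.Modules.pullback Gr).obj P.D.P) 3) 1 :=
    hasRank_tensorPow_one (hasRank_pullback Gr P.D.hasRank_one) 3
  let fQd := HasRank.isFiniteLocallyFree' hQd
  let fQ := HasRank.isFiniteLocallyFree' hQ
  -- the class of the twist dies on the fibre: it is pulled back from `Spec K`
  have hk : CechPic.pullback i (detClass fQ) = 1 :=
    calc CechPic.pullback i (detClass fQ)
        = CechPic.pullback i (CechPic.pullback P.A.X.hom (detClass fQd)) :=
          congrArg (CechPic.pullback i) ((detClass_eq_of_iso (Iso.refl _) fQ (fQd.pullback _)).trans (detClass_pullback _ fQd))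
      _ = CechPic.pullback (i ≫ P.A.X.hom) (detClass fQd) := (CechPic.pullback_comp i P.A.X.hom _).symm
      _ = CechPic.pullback (f₀ ≫ x) (detClass fQd) := congrArg (CechPic.pullback · (detClass fQd)) H.w
      _ = CechPic.pullback f₀ (CechPic.pullback x (detClass fQd)) := CechPic.pullback_comp f₀ x _
      _ = 1 := by rw [CechPic.eq_one_of_isLocalRing (CechPic.pullback x (detClass fQd)), map_one]
  obtain ⟨φ⟩ := nonempty_pullback_iso_pullback_of_nonempty_tensorObj_iso hL hM3 hQ hV i hk
  haveI := P.pol.subsingleton_ext_one_pullback_LDelta_tensorPow' P.A P.D Gr hGr₁ hGr₂ x H (m := 3) (by norm_num)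
  exact Modules.subsingleton_ext_of_iso (unitModule X₀) φ 1

end Vanishing

/-! ## §2 The point of `𝐏^m` of a framed `L` with `L` normalised `≅ L^Δ(λ)^{⊗3}` is a linear rigidification -/

section Rigidification

variable [IsLocallyNoetherian T] (F : FrameSystem L) (h1 : ∀ x, F.rank x = 1)
  (e : SheafOfModules.free (Fin (Nat.card J + 1)) ≅ ((Scheme.Modules.pushforward P.A.X.hom).obj L).over ⊤)
  (hcov : ⨆ i, ⨆ x, P.A.X.left.basicOpen
    ((CocycleSections.ofFrameSystem F h1 fun j ↦ (basisSection e j :)).coeff i x) = ⊤)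

include hL hGr₁ hGr₂ hV in
/-- **Over a base change killing the class of `(ε^*L)^∨`, the point of `𝐏^m` of the frame sections is the morphism of a GLOBAL
FRAME of `π″_*(L^Δ(λ″)^{⊗3})`** — ★ (8α) `IsFrameRigidification` of the restricted triple `P|_{T″}` at `X ×_T T″ → X → 𝐏^m_ℤ`.
This is ★ (8α-BC) `IsBaseChangeVia.isFrameRigidification_comp` with the framed module `L` in place of `(Gr^*𝒫)^{⊗3}`: the graph
`Gr″ = (1, λ″)` of `P|_{T″}`; the module isomorphism `φ : G^*L ≅ (Gr″^*𝒫″)^{⊗3}` — `G^*L ≅ G^*(Gr^*𝒫)^{⊗3}` because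
`[G^*π^*(ε^*L)^∨] = π″^*(v^*[(ε^*L)^∨]) = 1` (§0), then ★ `nonempty_pullback_tensorPow_iso` and ★
`IsBaseChangeVia.nonempty_iso_pullback_LDelta` at ★ `baseChange_isBaseChangeVia`; the frame system `F` pulled back and moved across
`φ`; and the transported frame of ★ `Morphisms.exists_frame_homEquiv_pointOfSections_eq_comp` (cohomology and base change for the
framed `π_*L` along the cartesian square, `H¹ = 0` on fibres by §1), whose point of `𝐏^m` is `G ≫` the point of `e`.
[cite: MumfordFogartyKirwan1994, Ch. 7 §2 Def. 7.5 (p. 130) and Prop. 7.6 (p. 136)] [cite: MumfordAV1970, §5 Cor. 3 (p. 53)]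
[cite: Hartshorne1977, II Thm. 7.1 (p. 150)] -/
theorem isFrameRigidification_baseChange_of_cechPic_pullback_eq_one {T'' : Scheme.{0}} (v : T'' ⟶ T)
    (hv : CechPic.pullback v
      (detClass (HasRank.isFiniteLocallyFree' (hasRank_dual (hasRank_pullback P.A.unitSection hL)))) = 1) :
    (P.baseChange v).IsFrameRigidification J (pullback.fst P.A.X.hom v ≫
      projectiveSpace.homEquiv (Over.mk P.A.X.hom)
        (projectiveSpace.pointOfSections (Over.mk P.A.X.hom)
          (ofCocycleSections F.U (CocycleSections.ofFrameSystem F h1 fun j ↦ (basisSection e j :)) hcov))) := by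
  have h := P.baseChange_isBaseChangeVia v
  -- the graph `Gr″ = (1, λ″)` of `P|_{T″}`
  let Gr'' : (P.baseChange v).A.X.left ⟶ (P.baseChange v).A.prodLeft (P.baseChange v).D.hat :=
    pullback.lift (𝟙 _) (P.baseChange v).pol.lam.left
      (by rw [Category.id_comp]; exact (Over.w (P.baseChange v).pol.lam).symm)
  have hGr''₁ : Gr'' ≫ pullback.fst (P.baseChange v).A.X.hom (P.baseChange v).D.hat.X.hom = 𝟙 _ :=
    pullback.lift_fst _ _ _
  have hGr''₂ : Gr'' ≫ pullback.snd (P.baseChange v).A.X.hom (P.baseChange v).D.hat.X.hom = (P.baseChange v).pol.lam.left :=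
    pullback.lift_snd _ _ _
  -- `G^*(Gr^*𝒫)^{⊗3} ≅ (Gr″^*𝒫″)^{⊗3}`
  obtain ⟨ψ⟩ := h.nonempty_iso_pullback_LDelta Gr hGr₁ hGr₂ Gr'' hGr''₁ hGr''₂
  have hL1 : HasRank ((Scheme.Modules.pullback Gr).obj P.D.P) 1 := hasRank_pullback Gr P.D.hasRank_one
  obtain ⟨τ⟩ := nonempty_pullback_tensorPow_iso (M := (Scheme.Modules.pullback Gr).obj P.D.P) (pullback.fst P.A.X.hom v) hL1 3
  obtain ⟨σ⟩ := AbelianSchemeOver.DualPair.nonempty_tensorPow_iso_of_iso ψ 3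
  -- `G^*L ≅ G^*(Gr^*𝒫)^{⊗3}`: the class of the twist dies on `X ×_T T″`
  have hM3 : HasRank (tensorPow ((Scheme.Modules.pullback Gr).obj P.D.P) 3) 1 := hasRank_tensorPow_one hL1 3
  have hεL : HasRank ((Scheme.Modules.pullback P.A.unitSection).obj L) 1 := hasRank_pullback _ hL
  have hQd : HasRank (Modules.dual ((Scheme.Modules.pullback P.A.unitSection).obj L)) 1 := hasRank_dual hεL
  have hQ : HasRank ((Scheme.Modules.pullback P.A.X.hom).obj
      (Modules.dual ((Scheme.Modules.pullback P.A.unitSection).obj L))) 1 := hasRank_pullback _ hQd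
  let fQd := HasRank.isFiniteLocallyFree' hQd
  let fQ := HasRank.isFiniteLocallyFree' hQ
  -- the cartesian square of the base change
  obtain ⟨-, hpb, -, -⟩ := h.1.1
  have hk : CechPic.pullback (pullback.fst P.A.X.hom v) (detClass fQ) = 1 :=
    calc CechPic.pullback (pullback.fst P.A.X.hom v) (detClass fQ)
        = CechPic.pullback (pullback.fst P.A.X.hom v) (CechPic.pullback P.A.X.hom (detClass fQd)) :=
          congrArg (CechPic.pullback (pullback.fst P.A.X.hom v))
            ((detClass_eq_of_iso (Iso.refl _) fQ (fQd.pullback _)).trans (detClass_pullback _ fQd))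
      _ = CechPic.pullback (pullback.fst P.A.X.hom v ≫ P.A.X.hom) (detClass fQd) :=
          (CechPic.pullback_comp (pullback.fst P.A.X.hom v) P.A.X.hom _).symm
      _ = CechPic.pullback ((P.baseChange v).A.X.hom ≫ v) (detClass fQd) :=
          congrArg (CechPic.pullback · (detClass fQd)) hpb.w
      _ = CechPic.pullback (P.baseChange v).A.X.hom (CechPic.pullback v (detClass fQd)) := CechPic.pullback_comp _ v _
      _ = 1 := by rw [hv, map_one]
  obtain ⟨κ⟩ := nonempty_pullback_iso_pullback_of_nonempty_tensorObj_iso hL hM3 hQ hV (pullback.fst P.A.X.hom v) hk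
  let φ : (Scheme.Modules.pullback (pullback.fst P.A.X.hom v)).obj L ≅
      tensorPow ((Scheme.Modules.pullback Gr'').obj (P.baseChange v).D.P) 3 := κ ≪≫ τ ≪≫ σ
  -- the frame system `F` pulled back along `G` and moved across `φ` (structure literal, as in ★ (W) / ★ (8α-BC))
  have h1G : ∀ x, (F.pullback (pullback.fst P.A.X.hom v)).rank x = 1 := fun x ↦ h1 ((pullback.fst P.A.X.hom v).base x)
  let Fφ : FrameSystem (tensorPow ((Scheme.Modules.pullback Gr'').obj (P.baseChange v).D.P) 3) :=
    { U := (F.pullback (pullback.fst P.A.X.hom v)).U, mem := (F.pullback (pullback.fst P.A.X.hom v)).mem,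
      I := (F.pullback (pullback.fst P.A.X.hom v)).I, rank := (F.pullback (pullback.fst P.A.X.hom v)).rank,
      enum := (F.pullback (pullback.fst P.A.X.hom v)).enum,
      frame := fun x => (F.pullback (pullback.fst P.A.X.hom v)).frame x ≪≫
        (SheafOfModules.overFunctor _ ((F.pullback (pullback.fst P.A.X.hom v)).U x)).mapIso φ }
  have h1φ : ∀ x, Fφ.rank x = 1 := h1G
  haveI : IsProper P.A.X.hom := P.A.isProper
  haveI : Smooth P.A.X.hom := P.A.isSmooth
  obtain ⟨e'', hcov'', heq⟩ := Morphisms.exists_frame_homEquiv_pointOfSections_eq_comp P.A.X.hom hpb F h1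
    (fun K _ X₀ i f₀ x H ↦
      P.subsingleton_ext_one_pullback_of_nonempty_normalised_iso Gr hGr₁ hGr₂ hL hV x H)
    φ Fφ h1φ J e hcov
  exact ⟨Gr'', hGr''₁, hGr''₂, Fφ, h1φ, e'', hcov'', heq⟩

include hL hGr₁ hGr₂ hV in
/-- **THE POINT OF `𝐏^m` OF A FRAMED `L` WITH `L ⊗ π^*(ε^*L)^∨ ≅ L^Δ(λ)^{⊗3}` IS A LINEAR RIGIDIFICATION** ([MumfordFogartyKirwan1994]
Prop. 7.6 for the universal family of Prop. 7.3: «`Z_H ⊂ ℙ^m × H` is a linear rigidification of `Z_H/H` with respect to `L^Δ(λ)³`»):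
for a triple `P` over a locally Noetherian `T`, a graph datum `Gr = (1, λ)`, a rank-one `L` on `X` whose normalisation is
`(Gr^*𝒫)^{⊗3}`, and a global frame `e : 𝒪_T^{m+1} ≅ π_*L` whose basis sections generate (read in a rank-one frame system `F`), the
`𝐏^m_ℤ`-component of the point of `𝐏(J; T)` they define is a ★ (8α) `IsLinearRigidification` of `P`: cover `T` by opens killing the
class of `(ε^*L)^∨` (§0 `exists_openCover_cechPic_pullback_eq_one`) and apply `isFrameRigidification_baseChange_of_cechPic_pullback_eq_one`
on each member — which is the definition of `IsLinearRigidification`.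
[cite: MumfordFogartyKirwan1994, Ch. 7 §2 Prop. 7.6 (p. 136) and Def. 7.5 (p. 130)] [cite: MumfordFogartyKirwan1994, Ch. 7 §2 Prop. 7.3, steps (V)–(VI) of the proof (p. 134)]
[cite: Hartshorne1977, II Thm. 7.1 (p. 150)] -/
theorem isLinearRigidification_homEquiv_pointOfSections_of_nonempty_normalised_iso :
    P.IsLinearRigidification J (projectiveSpace.homEquiv (Over.mk P.A.X.hom)
      (projectiveSpace.pointOfSections (Over.mk P.A.X.hom)
        (ofCocycleSections F.U (CocycleSections.ofFrameSystem F h1 fun j ↦ (basisSection e j :)) hcov))) := by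
  obtain ⟨𝒰, h𝒰⟩ := exists_openCover_cechPic_pullback_eq_one
    (detClass (HasRank.isFiniteLocallyFree' (hasRank_dual (hasRank_pullback P.A.unitSection hL))))
  exact ⟨𝒰, fun i ↦ P.isFrameRigidification_baseChange_of_cechPic_pullback_eq_one J Gr hGr₁ hGr₂ hL hV F h1 e hcov
    (𝒰.f i) (h𝒰 i)⟩

include hL hGr₁ hGr₂ hV hcov in
/-- **The same, for a given embedding `ι : X → 𝐏^m_ℤ` identified with the point of the frame sections** (the consumer's form: the
(H-rep) file identifies the inclusion `Z_H → ℙ^m × H → 𝐏^m_ℤ` with the point of the coordinate frame of `π_*𝒪(1)` by Hartshorne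
II 7.1 uniqueness and concludes `IsLinearRigidification J P_H emb` by this theorem).
[cite: MumfordFogartyKirwan1994, Ch. 7 §2 Prop. 7.6 (p. 136)] [cite: Hartshorne1977, II Thm. 7.1 (p. 150)] -/
theorem isLinearRigidification_of_homEquiv_pointOfSections_eq (ι : P.A.X.left ⟶ projectiveSpaceInt J)
    (hι : projectiveSpace.homEquiv (Over.mk P.A.X.hom)
      (projectiveSpace.pointOfSections (Over.mk P.A.X.hom)
        (ofCocycleSections F.U (CocycleSections.ofFrameSystem F h1 fun j ↦ (basisSection e j :)) hcov)) = ι) :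
    P.IsLinearRigidification J ι :=
  hι ▸ P.isLinearRigidification_homEquiv_pointOfSections_of_nonempty_normalised_iso J Gr hGr₁ hGr₂ hL hV F h1 e hcov

end Rigidification

end PolarizedAbelianSchemeWithLevel

/-! ## §3 The adapter: clause (V) of the F-6 files gives `hV` for the universal family -/

namespace AbelianSchemeOver

variable {S : Scheme.{0}} (A : AbelianSchemeOver S) (D : A.DualPair) (L₀ : A.left.Modules) (hL₀ : HasRank L₀ 1)
  {T : Scheme.{0}} (b : T ⟶ S) (pol : (A.baseChange b).Polarization (D.baseChange b))
  (Γ₁ : (A.baseChange b).left ⟶ A.prodLeft D.hat)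
  (hΓ₁₁ : Γ₁ ≫ pullback.fst A.X.hom D.hat.X.hom = pullback.fst A.X.hom b)
  (hΓ₁₂ : Γ₁ ≫ pullback.snd A.X.hom D.hat.X.hom = pol.lam.left ≫ pullback.fst D.hat.X.hom b)
  (e : Nonempty ((Scheme.Modules.pullback (pullback.fst A.X.hom b)).obj
      (tensorObj L₀ ((Scheme.Modules.pullback A.X.hom).obj
        (Modules.dual ((Scheme.Modules.pullback A.unitSection).obj L₀)))) ≅
    tensorPow ((Scheme.Modules.pullback Γ₁).obj D.P) 3))

include hL₀ hΓ₁₁ hΓ₁₂ e in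
/-- **Clause (V) ⇒ `hV` for the universal family**: over `b : T → S`, for a polarisation `pol` of `A_T` with graph
`Γ₁ = (pr, λ ≫ pr̂) : A_T → A ×_S Â` over `S` and clause (V) `pr^*(L₀ ⊗ π^*(ε^*L₀)^∨) ≅ (Γ₁^*𝒫)^{⊗3}`, the rank-one module
`pr^*L₀` on `A_T`, NORMALISED ALONG `ε_T`, is `(Gr^*𝒫_T)^{⊗3}` for the graph `Gr = (1, λ)` of `A_T` over `T` — normalisation commutes
with base change (★ `nonempty_pullback_normalised_iso_normalised_pullback`, [MumfordFogartyKirwan1994] Def. 6.2) and `Γ₁ = Gr ≫ (A_T ×_T Â_T → A ×_S Â)`,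
`𝒫_T = ` the pull-back of `𝒫`.  Feeds §2 at the (H-rep) file's universal triple `(A_T, λ, σ_T)`.
[cite: MumfordFogartyKirwan1994, Ch. 7 §2 Prop. 7.3, step (V) of the proof (p. 134)] [cite: MumfordFogartyKirwan1994, Ch. 6 §2 Definition 6.2 (p. 120)] -/
theorem nonempty_normalised_pullback_iso_graph_tensorPow_of_LDelta_cube
    (Gr : (A.baseChange b).X.left ⟶ (A.baseChange b).prodLeft (D.hatBaseChange b))
    (hGr₁ : Gr ≫ pullback.fst (A.baseChange b).X.hom (D.hatBaseChange b).X.hom = 𝟙 _)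
    (hGr₂ : Gr ≫ pullback.snd (A.baseChange b).X.hom (D.hatBaseChange b).X.hom = pol.lam.left) :
    Nonempty (tensorObj ((Scheme.Modules.pullback (pullback.fst A.X.hom b)).obj L₀)
        ((Scheme.Modules.pullback (A.baseChange b).X.hom).obj (Modules.dual
          ((Scheme.Modules.pullback (A.baseChange b).unitSection).obj
            ((Scheme.Modules.pullback (pullback.fst A.X.hom b)).obj L₀)))) ≅
      tensorPow ((Scheme.Modules.pullback Gr).obj (D.baseChange b).P) 3) := by
  obtain ⟨e⟩ := e
  obtain ⟨n⟩ := A.nonempty_pullback_normalised_iso_normalised_pullback b hL₀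
  -- `Γ₁ = Gr ≫ (A_T ×_T Â_T → A ×_S Â)` and `Gr^*𝒫_T ≅ Γ₁^*𝒫`
  have hΓ : Γ₁ = Gr ≫ D.prodBaseChangeToProd b := by
    apply pullback.hom_ext
    · rw [hΓ₁₁, Category.assoc, D.prodBaseChangeToProd_fst, ← Category.assoc, hGr₁, Category.id_comp]
    · rw [hΓ₁₂, Category.assoc, D.prodBaseChangeToProd_snd, ← Category.assoc, hGr₂]
  have c₀ : (Scheme.Modules.pullback Gr).obj (D.baseChange b).P ≅ (Scheme.Modules.pullback Γ₁).obj D.P :=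
    (Scheme.Modules.pullbackComp Gr (D.prodBaseChangeToProd b)).app D.P ≪≫
      (Scheme.Modules.pullbackCongr hΓ.symm).app D.P
  obtain ⟨σ⟩ := DualPair.nonempty_tensorPow_iso_of_iso c₀.symm 3
  exact ⟨n.symm ≪≫ e ≪≫ σ⟩

end AbelianSchemeOver

end Literature.AlgebraicGeometry.AbelianSchemes

end
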